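import Mathlib
import Literature.Geometry.DiscreteGeometry.BondGraph
import Literature.MathematicalPhysics.StatisticalMechanics.BarlowStacking
import Literature.MathematicalPhysics.StatisticalMechanics.PeriodicConfigurationSums
import Summits.AtomisticToContinuum.Crystallization.Theorems.ChargedEnergyGap.Negative.PeriodicForm
import HarnessLib

/-!
# Line `barlow-relative-pricing` (crux `PricedLinkCensus.ChargedEnergyGap`,
# stmt-AtomisticToContinuum-14231): periodic gross pricing implies the gross floor

Stub `stub_grossFloorOfPeriodic` of the line skeleton: the TRANSFER from the periodic gross
pricing to finite separated configurations.  A site `i` of a configuration `y` (any index type)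
is `(ε, R)`-BARLOW-NEAR if its own nearest-neighbour distance `a = nn_i`
(`Literature.Geometry.DiscreteGeometry.nearestDist`) is positive, the sites within `R·a` of
`y i` are pairwise `a/2`-separated, and they are two-way `ε·a`-matched with a rigid image
`g '' barlowStacking a (a√(2/3)) s` of an ideal Barlow stacking (`g` an affine isometry of
`ℝ³`, `s` a Hägg word).  HYPOTHESIS (periodic gross pricing, the open neighbouring stub): there
is `c > 0` such that every periodic configuration `Q` of `ℝ³` satisfies
`c · #{motif points of Q not (1/40, 3)-near in the point set Q.points} ≤ #motif · (e(Q) − e_B)`,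
`e_B` the Barlow reference energy (an opaque real here).  CONCLUSION: for every `δ₀ > 0` there
are `c > 0`, `C` with `N·e_B + c·#{i not (1/40,3)-near in y} − C·N^(2/3) ≤ E(y)` for every
`δ₀`-separated `y : Fin N → ℝ³` (`E` the finite Lennard-Jones energy).

Proof (the analogue of `ChargedEnergyGapNegative.noBoundary_of_periodicPricing`, with "charged"
replaced by "not Barlow-near").  Take the same `c` and `C = c + max e_B 0`.  For `N ≤ 1` the
energy vanishes and the at most one non-near site is absorbed by `C·N^(2/3)`.  For `N ≥ 2`
(separation gives injectivity) periodise `y` far apart, `Q = periodiseFar y` (period `8D + 8`,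
`D = Σ‖yᵢ‖`): then `e(Q) ≤ E(y)/N` (`energyPerParticle_periodise_le`), `#motif = N`, and every
motif point `yᵢ` that is Barlow-near in `Q.points` is Barlow-near in `y` (`near_of_near_image`:
the nearest-neighbour distance `a ≤ D` is unchanged, `nearestDist_toPoint`, and a point of
`Q.points` within `(3 + 1/40)·a ≤ 4D < 6D + 8` of `yᵢ` is a motif point, so the separation and
the two matching clauses transfer literally), whence `#nonNear(y) ≤ #gross(Q)` and
`N·e_B + c·#nonNear(y) ≤ N·e(Q) ≤ E(y)`.  The converse transfer `near_image_of_near` (not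
needed for the stub) is recorded for reuse.  The reference energy and the two nearness
predicates enter only through the final signature: the assembly `floor_of_periodic` is stated
for an arbitrary reference `e` and arbitrary predicates `P` (on motif points of periodic
configurations) and `p` (on sites of finite ones) linked at far periodisations.  All `[folklore]`.
-/

noncomputable section

namespace Summit.AtomisticToContinuum.Crystallization.Theorems.BarlowRelativePricingPeriodic

open scoped BigOperators
open Literature.MathematicalPhysics.StatisticalMechanics Literature.Geometry.DiscreteGeometry
open Summit.AtomisticToContinuum.Crystallization.Theorems.ChargedEnergyGapNegative

/-! ## Geometry of the far periodisation -/

/-- Two distinct sites are at distance at most `D(y) = Σ‖yᵢ‖`. [folklore] -/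
theorem dist_le_Dsum {N : ℕ} (y : Fin N → E3) {i j : Fin N} (h : i ≠ j) :
    dist (y i) (y j) ≤ Dsum y := by
  have h2 : ‖y i‖ + ‖y j‖ ≤ Dsum y := by
    have := Finset.sum_le_sum_of_subset_of_nonneg (f := fun k => ‖y k‖)
      (Finset.subset_univ ({i, j} : Finset (Fin N))) (fun _ _ _ => norm_nonneg _)
    rwa [Finset.sum_pair h] at this
  rw [dist_eq_norm]
  exact (norm_sub_le _ _).trans h2

/-- Hence nearest-neighbour distances are at most `D(y)` (when there is another site). [folklore] -/
theorem nearestDist_le_Dsum {N : ℕ} (y : Fin N → E3) {i j : Fin N} (h : j ≠ i) :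
    nearestDist y i ≤ Dsum y :=
  (nearestDist_le_dist y h).trans (dist_le_Dsum y h.symm)

/-- A point of the far periodisation within `K·nn_i` of `yᵢ`, `K ≤ 6`, is a motif point `yⱼ`
(the other points are `≥ 6D + 8` away, `eq_toPoint_or_far`, while `nn_i ≤ D`). [folklore] -/
theorem exists_toPoint_eq_of_dist_le_mul {N : ℕ} {y : Fin N → E3} (hN : 0 < N) {i : Fin N}
    (hi : ∃ j, j ≠ i) {K : ℝ} (hK : K ≤ 6) (q : (periodiseFar y hN).points)
    (hq : dist (y i) q ≤ K * nearestDist y i) : ∃ j, toPoint y hN j = q := by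
  rcases eq_toPoint_or_far hN q with ⟨j, rfl⟩ | hfar
  · exact ⟨j, rfl⟩
  · exfalso
    obtain ⟨j₀, hj₀⟩ := hi
    have ha : nearestDist y i ≤ Dsum y := nearestDist_le_Dsum y hj₀
    have h0 : 0 ≤ nearestDist y i := nearestDist_nonneg y i
    have hf := hfar i
    have h6 : K * nearestDist y i ≤ 6 * nearestDist y i := mul_le_mul_of_nonneg_right hK h0
    nlinarith [Dsum_nonneg y]

/-- In particular for `K = 3 + 1/40` (radius `3`, precision `1/40`). [folklore] -/
theorem exists_toPoint_eq_of_dist_le {N : ℕ} {y : Fin N → E3} (hN : 0 < N) {i : Fin N}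
    (hi : ∃ j, j ≠ i) (q : (periodiseFar y hN).points)
    (hq : dist (y i) q ≤ (3 + 1 / 40) * nearestDist y i) : ∃ j, toPoint y hN j = q :=
  exists_toPoint_eq_of_dist_le_mul hN hi (by norm_num) q hq

/-! ## Transfer of Barlow-nearness along an injection of configurations -/

/-- **Barlow-nearness transfers back along an injection of configurations.**  Let `f : ι → κ`
be injective with `w ∘ f = y`, let the nearest-neighbour distance of `f i` in `w` be that of `i`
in `y`, and let every site of `w` within `(R + ε)·nn_i` of `y i` be in the image of `f`.  If
`f i` is `(ε, R)`-Barlow-near in `w`, then `i` is `(ε, R)`-Barlow-near in `y` (same Hägg word,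
same chart). [folklore] -/
theorem near_of_near_image {ι κ : Type*} {y : ι → E3} {w : κ → E3} {f : ι → κ}
    (hf : Function.Injective f) (hwf : ∀ j, w (f j) = y j) {i : ι}
    (hnn : nearestDist w (f i) = nearestDist y i) {ε R : ℝ}
    (hcov : ∀ q : κ, dist (y i) (w q) ≤ (R + ε) * nearestDist y i → ∃ j, f j = q)
    (h : 0 < nearestDist w (f i) ∧
      (∀ j k : κ, j ≠ k → dist (w (f i)) (w j) ≤ R * nearestDist w (f i) →
        dist (w (f i)) (w k) ≤ R * nearestDist w (f i) →
          nearestDist w (f i) / 2 ≤ dist (w j) (w k)) ∧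
      ∃ (s : ℤ → ℤ) (g : E3 ≃ᵃⁱ[ℝ] E3), IsHaggSeq s ∧
        (∀ j : κ, dist (w (f i)) (w j) ≤ R * nearestDist w (f i) →
          ∃ z ∈ barlowStacking (nearestDist w (f i)) (nearestDist w (f i) * Real.sqrt (2 / 3)) s,
            dist (w j) (g z) ≤ ε * nearestDist w (f i)) ∧
        (∀ z ∈ barlowStacking (nearestDist w (f i)) (nearestDist w (f i) * Real.sqrt (2 / 3)) s,
          dist (w (f i)) (g z) ≤ R * nearestDist w (f i) →
            ∃ j : κ, dist (w j) (g z) ≤ ε * nearestDist w (f i))) :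
    0 < nearestDist y i ∧
      (∀ j k : ι, j ≠ k → dist (y i) (y j) ≤ R * nearestDist y i →
        dist (y i) (y k) ≤ R * nearestDist y i → nearestDist y i / 2 ≤ dist (y j) (y k)) ∧
      ∃ (s : ℤ → ℤ) (g : E3 ≃ᵃⁱ[ℝ] E3), IsHaggSeq s ∧
        (∀ j : ι, dist (y i) (y j) ≤ R * nearestDist y i →
          ∃ z ∈ barlowStacking (nearestDist y i) (nearestDist y i * Real.sqrt (2 / 3)) s,
            dist (y j) (g z) ≤ ε * nearestDist y i) ∧
        (∀ z ∈ barlowStacking (nearestDist y i) (nearestDist y i * Real.sqrt (2 / 3)) s,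
          dist (y i) (g z) ≤ R * nearestDist y i →
            ∃ j : ι, dist (y j) (g z) ≤ ε * nearestDist y i) := by
  rw [hnn, hwf i] at h
  obtain ⟨hpos, hsep, s, g, hs, h₁, h₂⟩ := h
  refine ⟨hpos, fun j k hjk hj hk => ?_, s, g, hs, fun j hj => ?_, fun z hz hzi => ?_⟩
  · have := hsep (f j) (f k) (hf.ne hjk) (by rw [hwf]; exact hj) (by rw [hwf]; exact hk)
    rwa [hwf, hwf] at this
  · obtain ⟨z, hz, hd⟩ := h₁ (f j) (by rw [hwf]; exact hj)
    exact ⟨z, hz, by rw [hwf] at hd; exact hd⟩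
  · obtain ⟨q, hq⟩ := h₂ z hz hzi
    obtain ⟨j, rfl⟩ := hcov q (by
      calc dist (y i) (w q) ≤ dist (y i) (g z) + dist (w q) (g z) := dist_triangle_right _ _ _
        _ ≤ R * nearestDist y i + ε * nearestDist y i := add_le_add hzi hq
        _ = (R + ε) * nearestDist y i := by ring)
    exact ⟨j, by rw [hwf] at hq; exact hq⟩

/-- **Conversely, Barlow-nearness transfers forward** (no injectivity needed, `ε ≥ 0`): if `i`
is `(ε, R)`-Barlow-near in `y`, then `f i` is `(ε, R)`-Barlow-near in `w` — the sites of `w`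
in the `R·nn_i`-ball around `y i` are images `f j`, so the clauses are those of `y`. [folklore] -/
theorem near_image_of_near {ι κ : Type*} {y : ι → E3} {w : κ → E3} {f : ι → κ}
    (hwf : ∀ j, w (f j) = y j) {i : ι}
    (hnn : nearestDist w (f i) = nearestDist y i) {ε R : ℝ} (hε : 0 ≤ ε)
    (hcov : ∀ q : κ, dist (y i) (w q) ≤ (R + ε) * nearestDist y i → ∃ j, f j = q)
    (h : 0 < nearestDist y i ∧
      (∀ j k : ι, j ≠ k → dist (y i) (y j) ≤ R * nearestDist y i →
        dist (y i) (y k) ≤ R * nearestDist y i → nearestDist y i / 2 ≤ dist (y j) (y k)) ∧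
      ∃ (s : ℤ → ℤ) (g : E3 ≃ᵃⁱ[ℝ] E3), IsHaggSeq s ∧
        (∀ j : ι, dist (y i) (y j) ≤ R * nearestDist y i →
          ∃ z ∈ barlowStacking (nearestDist y i) (nearestDist y i * Real.sqrt (2 / 3)) s,
            dist (y j) (g z) ≤ ε * nearestDist y i) ∧
        (∀ z ∈ barlowStacking (nearestDist y i) (nearestDist y i * Real.sqrt (2 / 3)) s,
          dist (y i) (g z) ≤ R * nearestDist y i →
            ∃ j : ι, dist (y j) (g z) ≤ ε * nearestDist y i)) :
    0 < nearestDist w (f i) ∧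
      (∀ j k : κ, j ≠ k → dist (w (f i)) (w j) ≤ R * nearestDist w (f i) →
        dist (w (f i)) (w k) ≤ R * nearestDist w (f i) →
          nearestDist w (f i) / 2 ≤ dist (w j) (w k)) ∧
      ∃ (s : ℤ → ℤ) (g : E3 ≃ᵃⁱ[ℝ] E3), IsHaggSeq s ∧
        (∀ j : κ, dist (w (f i)) (w j) ≤ R * nearestDist w (f i) →
          ∃ z ∈ barlowStacking (nearestDist w (f i)) (nearestDist w (f i) * Real.sqrt (2 / 3)) s,
            dist (w j) (g z) ≤ ε * nearestDist w (f i)) ∧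
        (∀ z ∈ barlowStacking (nearestDist w (f i)) (nearestDist w (f i) * Real.sqrt (2 / 3)) s,
          dist (w (f i)) (g z) ≤ R * nearestDist w (f i) →
            ∃ j : κ, dist (w j) (g z) ≤ ε * nearestDist w (f i)) := by
  rw [hnn, hwf i]
  obtain ⟨hpos, hsep, s, g, hs, h₁, h₂⟩ := h
  have hRle : R * nearestDist y i ≤ (R + ε) * nearestDist y i := by nlinarith
  refine ⟨hpos, fun q q' hqq' hq hq' => ?_, s, g, hs, fun q hq => ?_, fun z hz hzi => ?_⟩
  · obtain ⟨j, rfl⟩ := hcov q (hq.trans hRle)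
    obtain ⟨k, rfl⟩ := hcov q' (hq'.trans hRle)
    rw [hwf] at hq hq'
    rw [hwf, hwf]
    exact hsep j k (fun hjk => hqq' (by rw [hjk])) hq hq'
  · obtain ⟨j, rfl⟩ := hcov q (hq.trans hRle)
    rw [hwf] at hq ⊢
    exact h₁ j hq
  · obtain ⟨j, hj⟩ := h₂ z hz hzi
    exact ⟨f j, by rw [hwf]; exact hj⟩

/-! ## Counting and energy -/

/-- Pricing transfers along an injection `f : β → α` that maps non-`P'` elements to non-`P`
elements: `#{¬P'} ≤ #{¬P}`, so `c·#{¬P'} ≤ c·#{¬P} ≤ B` (`c ≥ 0`). [folklore] -/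
theorem pricing_le_of_injective {α β : Type*} [Finite α] {P : α → Prop} {P' : β → Prop}
    {c B : ℝ} (hc : 0 ≤ c) (hp : c * (Nat.card {a : α // ¬ P a} : ℝ) ≤ B) {f : β → α}
    (hf : Function.Injective f) (h : ∀ b, P (f b) → P' b) :
    c * (Nat.card {b : β // ¬ P' b} : ℝ) ≤ B := by
  have hle : Nat.card {b : β // ¬ P' b} ≤ Nat.card {a : α // ¬ P a} :=
    Nat.card_le_card_of_injective (fun b => ⟨f b.1, fun hb => b.2 (h b.1 hb)⟩)
      (fun b₁ b₂ hb => Subtype.ext (hf (congrArg Subtype.val hb)))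
  exact (mul_le_mul_of_nonneg_left (by exact_mod_cast hle) hc).trans hp

/-- **The case `N ≥ 1`, `y` injective**: periodic pricing at the far periodisation
`Q = y + (8D+8)ℤ³` gives `N·e + c·#{¬p} ≤ E(y)` as soon as every motif point `yᵢ` satisfying
`P` (read in `Q`) satisfies `p` (`#motif = N`, `e(Q) ≤ E(y)/N`). [folklore] -/
theorem floor_of_injective {e c : ℝ} (hc : 0 < c)
    {P : (Q : PeriodicConfiguration 3) → Q.motif → Prop}
    (hP : ∀ Q : PeriodicConfiguration 3,
      c * (Nat.card {x : Q.motif // ¬ P Q x} : ℝ) ≤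
        (Q.motif.card : ℝ) * (Q.energyPerParticle lennardJones - e))
    {N : ℕ} (hN0 : 0 < N) {y : Fin N → E3} (hy : Function.Injective y) {p : Fin N → Prop}
    (h : ∀ i, P (periodiseFar y hN0) ⟨y i, mem_motif_periodiseFar y hN0 i⟩ → p i) :
    (N : ℝ) * e + c * (Nat.card {i : Fin N // ¬ p i} : ℝ) ≤ interactionEnergy lennardJones y := by
  have hp := hP (periodiseFar y hN0)
  have hcard : (((periodiseFar y hN0).motif.card : ℕ) : ℝ) = N := by
    rw [motif_periodiseFar, Finset.card_image_of_injective _ hy, Finset.card_univ,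
      Fintype.card_fin]
  rw [hcard] at hp
  have hf : Function.Injective
      (fun i : Fin N => (⟨y i, mem_motif_periodiseFar y hN0 i⟩ : (periodiseFar y hN0).motif)) :=
    fun a b hab => hy (congrArg Subtype.val hab)
  have hp' : c * (Nat.card {i : Fin N // ¬ p i} : ℝ) ≤
      N * ((periodiseFar y hN0).energyPerParticle lennardJones - e) :=
    pricing_le_of_injective hc.le hp hf h
  have hNr : (0 : ℝ) < N := by exact_mod_cast hN0
  have he := energyPerParticle_periodise_le hy (spacingUnit y) (period_le_spacing y) hN0
  rw [le_div_iff₀ hNr, mul_comm] at he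
  have he' : (N : ℝ) * (periodiseFar y hN0).energyPerParticle lennardJones ≤
      interactionEnergy lennardJones y := he
  nlinarith

/-- **Assembly**: the gross floor with `C = c + max e 0` on `δ₀`-separated configurations, from
the periodic pricing (`hP`) and the pointwise transfer `P`-in-`Q` ⇒ `p`-in-`y` at motif points
of far periodisations of injective configurations with `N ≥ 2` (`hlink`); `N ≤ 1` is the
energy-free case. [folklore] -/
theorem floor_of_periodic {e c : ℝ} (hc : 0 < c)
    {P : (Q : PeriodicConfiguration 3) → Q.motif → Prop}
    (hP : ∀ Q : PeriodicConfiguration 3,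
      c * (Nat.card {x : Q.motif // ¬ P Q x} : ℝ) ≤
        (Q.motif.card : ℝ) * (Q.energyPerParticle lennardJones - e))
    {p : ∀ {N : ℕ}, (Fin N → E3) → Fin N → Prop}
    (hlink : ∀ (N : ℕ) (hN0 : 0 < N) (y : Fin N → E3), Function.Injective y →
      (∀ i : Fin N, ∃ j, j ≠ i) →
        ∀ i, P (periodiseFar y hN0) ⟨y i, mem_motif_periodiseFar y hN0 i⟩ → p y i)
    (δ₀ : ℝ) (hδ₀ : 0 < δ₀) :
    ∃ c : ℝ, 0 < c ∧ ∃ C : ℝ, ∀ (N : ℕ) (y : Fin N → E3),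
      (∀ i j : Fin N, i ≠ j → δ₀ ≤ dist (y i) (y j)) →
        (N : ℝ) * e + c * (Nat.card {i : Fin N // ¬ p y i} : ℝ) - C * (N : ℝ) ^ (2 / 3 : ℝ) ≤
          interactionEnergy lennardJones y := by
  refine ⟨c, hc, c + max e 0, fun N y hsep => ?_⟩
  rcases Nat.lt_or_ge N 2 with hN | hN
  · interval_cases N
    · have h0 : Nat.card {i : Fin 0 // ¬ p y i} = 0 := Nat.card_of_isEmpty
      rw [interactionEnergy_of_subsingleton, h0, Nat.cast_zero, Real.zero_rpow (by norm_num)]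
      simp
    · have h1 : (Nat.card {i : Fin 1 // ¬ p y i} : ℝ) ≤ 1 := by
        exact_mod_cast (Finite.card_subtype_le _).trans_eq (Nat.card_fin 1)
      rw [interactionEnergy_of_subsingleton, Nat.cast_one, one_mul, Real.one_rpow, mul_one]
      linarith [mul_le_of_le_one_right hc.le h1, le_max_left e 0]
  · have hN0 : 0 < N := by omega
    have hy : Function.Injective y := fun i j hij => by
      by_contra hne
      have := hsep i j hne
      rw [hij, dist_self] at this
      linarith
    have hN2 : ∀ i : Fin N, ∃ j, j ≠ i := exists_ne_of_two_le hN
    have hmain := floor_of_injective hc hP hN0 hy (hlink N hN0 y hy hN2)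
    have hC : 0 ≤ (c + max e 0) * (N : ℝ) ^ (2 / 3 : ℝ) :=
      mul_nonneg (add_nonneg hc.le (le_max_right e 0)) (Real.rpow_nonneg (Nat.cast_nonneg N) _)
    linarith

/-- **stub_grossFloorOfPeriodic** (line `barlow-relative-pricing`): PERIODIC GROSS PRICING IMPLIES
THE GROSS FLOOR on `δ₀`-separated finite configurations.  If some `c > 0` prices every periodic
configuration `Q` of `ℝ³` by `c · #{motif points not (1/40, 3)-Barlow-near in Q.points} ≤
#motif · (e(Q) − e_B)` (`e_B` the Barlow reference energy, the infimum of the Lennard-Jones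
energy per particle over the periodic Barlow stackings), then for every `δ₀ > 0` there are `c > 0`
and `C` with `N·e_B + c·#{sites not (1/40, 3)-Barlow-near in y} − C·N^(2/3) ≤ E(y)` for all
`δ₀`-separated `y : Fin N → ℝ³`.  Proof: `floor_of_periodic` with the transfer
`near_of_near_image` at the motif points `toPoint y _ i` of the far periodisation
(`nearestDist_toPoint`, `exists_toPoint_eq_of_dist_le`). [folklore] -/
theorem stub_grossFloorOfPeriodic : (∃ c : ℝ, 0 < c ∧ ∀ Q : Literature.MathematicalPhysics.StatisticalMechanics.PeriodicConfiguration 3, c * (Nat.card {x : Q.motif // ¬ (0 < Literature.Geometry.DiscreteGeometry.nearestDist (Subtype.val : Q.points → EuclideanSpace ℝ (Fin 3)) ⟨x.1, Q.mem_points_of_mem_motif x.2⟩ ∧ (∀ j k : Q.points, j ≠ k → dist ((Subtype.val : Q.points → EuclideanSpace ℝ (Fin 3)) ⟨x.1, Q.mem_points_of_mem_motif x.2⟩) ((Subtype.val : Q.points → EuclideanSpace ℝ (Fin 3)) j) ≤ 3 * Literature.Geometry.DiscreteGeometry.nearestDist (Subtype.val : Q.points → EuclideanSpace ℝ (Fin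 3)) ⟨x.1, Q.mem_points_of_mem_motif x.2⟩ → dist ((Subtype.val : Q.points → EuclideanSpace ℝ (Fin 3)) ⟨x.1, Q.mem_points_of_mem_motif x.2⟩) ((Subtype.val : Q.points → EuclideanSpace ℝ (Fin 3)) k) ≤ 3 * Literature.Geometry.DiscreteGeometry.nearestDist (Subtype.val : Q.points → EuclideanSpace ℝ (Fin 3)) ⟨x.1, Q.mem_points_of_mem_motif x.2⟩ → Literature.Geometry.DiscreteGeometry.nearestDist (Subtype.val : Q.points → EuclideanSpace ℝ (Fin 3)) ⟨x.1, Q.mem_points_of_mem_motif x.2⟩ / 2 ≤ dist ((Subtype.val : Q.points → EuclideanSpace ℝ (Fin 3)) j) ((Subtype.val : Q.points → EuclideanSpace ℝ (Fin 3)) k)) ∧ ∃ (s : ℤ → ℤ) (g : EuclideanSpace ℝ (Fin 3) ≃ᵃⁱ[ℝ] EuclideanSpace ℝ (Fin 3)), Literature.MathematicalPhysics.StatisticalMechanics.IsHaggSeq s ∧ (∀ j : Q.points, dist ((Subtype.val : Q.points → EuclideanSpace ℝ (Fin 3)) ⟨x.1, Q.mem_points_of_mem_motif x.2⟩) ((Subtype.val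 : Q.points → EuclideanSpace ℝ (Fin 3)) j) ≤ 3 * Literature.Geometry.DiscreteGeometry.nearestDist (Subtype.val : Q.points → EuclideanSpace ℝ (Fin 3)) ⟨x.1, Q.mem_points_of_mem_motif x.2⟩ → ∃ z ∈ Literature.MathematicalPhysics.StatisticalMechanics.barlowStacking (Literature.Geometry.DiscreteGeometry.nearestDist (Subtype.val : Q.points → EuclideanSpace ℝ (Fin 3)) ⟨x.1, Q.mem_points_of_mem_motif x.2⟩) (Literature.Geometry.DiscreteGeometry.nearestDist (Subtype.val : Q.points → EuclideanSpace ℝ (Fin 3)) ⟨x.1, Q.mem_points_of_mem_motif x.2⟩ * Real.sqrt (2 / 3)) s, dist ((Subtype.val : Q.points → EuclideanSpace ℝ (Fin 3)) j) (g z) ≤ (1 / 40 : ℝ) * Literature.Geometry.DiscreteGeometry.nearestDist (Subtype.val : Q.points → EuclideanSpace ℝ (Fin 3)) ⟨x.1, Q.mem_points_of_mem_motif x.2⟩) ∧ (∀ z ∈ Literature.MathematicalPhysics.StatisticalMechanics.barlowStacking (Literature.Geometry.DiscreteGeometry.nearestDist (Subtype.val : Q.points → EuclideanSpace ℝ (Fin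 3)) ⟨x.1, Q.mem_points_of_mem_motif x.2⟩) (Literature.Geometry.DiscreteGeometry.nearestDist (Subtype.val : Q.points → EuclideanSpace ℝ (Fin 3)) ⟨x.1, Q.mem_points_of_mem_motif x.2⟩ * Real.sqrt (2 / 3)) s, dist ((Subtype.val : Q.points → EuclideanSpace ℝ (Fin 3)) ⟨x.1, Q.mem_points_of_mem_motif x.2⟩) (g z) ≤ 3 * Literature.Geometry.DiscreteGeometry.nearestDist (Subtype.val : Q.points → EuclideanSpace ℝ (Fin 3)) ⟨x.1, Q.mem_points_of_mem_motif x.2⟩ → ∃ j : Q.points, dist ((Subtype.val : Q.points → EuclideanSpace ℝ (Fin 3)) j) (g z) ≤ (1 / 40 : ℝ) * Literature.Geometry.DiscreteGeometry.nearestDist (Subtype.val : Q.points → EuclideanSpace ℝ (Fin 3)) ⟨x.1, Q.mem_points_of_mem_motif x.2⟩))} : ℝ) ≤ (Q.motif.card : ℝ) * (Q.energyPerParticle Literature.MathematicalPhysics.StatisticalMechanics.lennardJones - (⨅ P : {t : ℝ × ℝ × ℕ × (ℤ → ℤ) // t.1 ≠ 0 ∧ t.2.1 ≠ 0 ∧ t.2.2.1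 ≠ 0 ∧ (∀ i : ℤ, t.2.2.2 (i + t.2.2.1) = t.2.2.2 i) ∧ Literature.MathematicalPhysics.StatisticalMechanics.IsHaggSeq t.2.2.2}, (Literature.MathematicalPhysics.StatisticalMechanics.barlowPeriodicConfiguration P.1.2.2.2 P.2.1 P.2.2.1 P.2.2.2.1 P.2.2.2.2.1).energyPerParticle Literature.MathematicalPhysics.StatisticalMechanics.lennardJones))) → ∀ δ₀ : ℝ, 0 < δ₀ → ∃ c : ℝ, 0 < c ∧ ∃ C : ℝ, ∀ (N : ℕ) (y : Fin N → EuclideanSpace ℝ (Fin 3)), (∀ i j : Fin N, i ≠ j → δ₀ ≤ dist (y i) (y j)) → (N : ℝ) * (⨅ P : {t : ℝ × ℝ × ℕ × (ℤ → ℤ) // t.1 ≠ 0 ∧ t.2.1 ≠ 0 ∧ t.2.2.1 ≠ 0 ∧ (∀ i : ℤ, t.2.2.2 (i + t.2.2.1) = t.2.2.2 i) ∧ Literature.MathematicalPhysics.StatisticalMechanics.IsHaggSeq t.2.2.2}, (Literature.MathematicalPhysics.StatisticalMechanics.barlowPeriodicConfiguration P.1.2.2.2 P.2.1 P.2.2.1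 P.2.2.2.1 P.2.2.2.2.1).energyPerParticle Literature.MathematicalPhysics.StatisticalMechanics.lennardJones) + c * (Nat.card {i : Fin N // ¬ (0 < Literature.Geometry.DiscreteGeometry.nearestDist y i ∧ (∀ j k : Fin N, j ≠ k → dist (y i) (y j) ≤ 3 * Literature.Geometry.DiscreteGeometry.nearestDist y i → dist (y i) (y k) ≤ 3 * Literature.Geometry.DiscreteGeometry.nearestDist y i → Literature.Geometry.DiscreteGeometry.nearestDist y i / 2 ≤ dist (y j) (y k)) ∧ ∃ (s : ℤ → ℤ) (g : EuclideanSpace ℝ (Fin 3) ≃ᵃⁱ[ℝ] EuclideanSpace ℝ (Fin 3)), Literature.MathematicalPhysics.StatisticalMechanics.IsHaggSeq s ∧ (∀ j : Fin N, dist (y i) (y j) ≤ 3 * Literature.Geometry.DiscreteGeometry.nearestDist y i → ∃ z ∈ Literature.MathematicalPhysics.StatisticalMechanics.barlowStacking (Literature.Geometry.DiscreteGeometry.nearestDist y i) (Literature.Geometry.DiscreteGeometry.nearestDist y i * Real.sqrt (2 / 3)) s, dist (y j) (g z) ≤ (1 / 40 : ℝ) * Literature.Geometry.DiscreteGeometry.nearestDist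 y i) ∧ (∀ z ∈ Literature.MathematicalPhysics.StatisticalMechanics.barlowStacking (Literature.Geometry.DiscreteGeometry.nearestDist y i) (Literature.Geometry.DiscreteGeometry.nearestDist y i * Real.sqrt (2 / 3)) s, dist (y i) (g z) ≤ 3 * Literature.Geometry.DiscreteGeometry.nearestDist y i → ∃ j : Fin N, dist (y j) (g z) ≤ (1 / 40 : ℝ) * Literature.Geometry.DiscreteGeometry.nearestDist y i))} : ℝ) - C * (N : ℝ) ^ (2 / 3 : ℝ) ≤ Literature.MathematicalPhysics.StatisticalMechanics.interactionEnergy Literature.MathematicalPhysics.StatisticalMechanics.lennardJones y :=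
  fun ⟨_, hc, hP⟩ δ₀ hδ₀ =>
    floor_of_periodic hc hP (fun _ hN0 y hy hN2 i hi =>
      near_of_near_image (toPoint_injective hy hN0) (val_toPoint y hN0)
        (nearestDist_toPoint hy hN0 (hN2 i)) (exists_toPoint_eq_of_dist_le hN0 (hN2 i)) hi) δ₀ hδ₀

end Summit.AtomisticToContinuum.Crystallization.Theorems.BarlowRelativePricingPeriodic

end
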